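import Summits.BirchSwinnertonDyer.BirchSwinnertonDyer.Theorems.SmallImageMuTransferMuTransferX9LocalTransverse
import Summits.BirchSwinnertonDyer.BirchSwinnertonDyer.Theorems.SmallImageMuTransferMuTransferX9LocalTwistOperator
import Summits.BirchSwinnertonDyer.Rank1Residual.GaloisImage.KolyvaginPrimeLocalShapeRat
import HarnessLib

/-!
# K6 crux `MuTransferX9` (stmt-BirchSwinnertonDyer-19276), CORE-PLAN S4.2 (file 3 of 3):
# MU-TRANSFER-PROOF §2 LEMMA 1 (ii) ASSEMBLED on the genuine local twist `𝒯_J|_{Γ_{K_q}}` at an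
# `E`-split prime: `H¹(K_q, 𝒯_J) = H¹_ur ⊕ H¹_tr`, `#H¹_ur = #H¹_tr = #𝒯_J[T^{p^m}] = #M^{p^m}`

Cell `bsd-smallim`, seat `bsd-smallim-koly` gen 7 (route `SmallImageMuTransfer`, rung K6, leaf
`Rank1Residual.BSDpOnClassX9`). HONEST FRAMING: TOOL theorems of local Galois cohomology and linear
algebra; no definition, no named fact, no `sorry`; nothing is asserted about any curve and nothing is
booked; class X9 stays TYPED at class level. The file serves the OPEN registered stub `stub_coreX9` of
crux 19276 (skeleton v4 0154dd5daf38efd6) — item "S4.2 Lemma 1 (local theory at E-split q, depth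
e_q = e) [OPEN, M] … to be matched to twistModP" of k6-c2's CORE-PLAN (evidence #12) — and credits
nothing toward its closure (`--supports … --as helper`). PARTITION (D-0054): X9 (A4) × p ∈ {5, 7}
(the statements are prime-generic, so also X10b ∧ ¬Surj at 3) — helper; closes NONE.

## Content

* `isCompl_unramified_transverse_toLocal_twistModP`: at a finite place `q ∤ p` of `K` with `ρ` unramified
  at `q`, `N(q) = ℓ` prime, `p ∣ ℓ − 1` and `χ̄_ℓ` onto on the inertia of `K_q`, the local cohomology of
  `𝒯_J = κ.twistModP ρ J` is the DIRECT SUM of its unramified and `K_q(μ_ℓ)`-transverse subgroups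
  (file 1 §1 applied with file 2 §0/§3).
* `natCard_transverse_toLocal_twistModP_of_split`: at an `E`-split Frobenius `φ` of depth `m`
  (`ρ(res φ) = 1`, `res φ ∈ Gal(K̄/K_m) ∖ Gal(K̄/K_{m+1})`, `m + 1 ≤ J`):
  `#H¹_tr(K_q, 𝒯_J) = #H¹_ur(K_q, 𝒯_J) = #𝒯_J[T^{p^m}]` (`= #M^{p^m}` by file 2's `natCard_shiftEnd_pow_ker`);
  at `J = 2e`, `e = p^m` this is the memo's `H¹_ur ≅ 𝒯_e`, `H¹_tr ≅ T^e𝒯_J ≅ 𝒯_e`.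
The `E`-split Frobenius of prescribed depth is supplied from Chebotarev's GLOBAL Frobenius by file 1's
`exists_isAbsArithFrob_split_of_isArithFrobAt`.
* Append no. 1: `forall_toLocal_twistModP_apply_eq_self_iff_of_split` (`(𝒯_J|_q)^{Γ_{K_q}} = 𝒯_J[T^{p^m}]`,
  the target of file 4's `H¹_tr ≃+ M^{Γ}` for the local twist) and
  `natCard_galoisCohomology_toLocal_twistModP_of_split` (`#H¹(K_q, 𝒯_J) = (#M^{p^m})²`).

References: HOME/koly/MU-TRANSFER-PROOF.md §2 Lemma 1 (referee PASS v4–v13); K. Rubin, PCMI 18 (2011)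
Prop. 1.9.5 [Rubin2011]; B. Mazur, K. Rubin, Mem. AMS 799 (2004) Lemmas 1.2.1, 1.2.4 [MazurRubin2004].
-/

set_option linter.dupNamespace false
set_option autoImplicit false

noncomputable section

open scoped Classical

universe u

namespace Summit.BirchSwinnertonDyer.BirchSwinnertonDyer.Rank1Residual.LocalSplitPrime

open CategoryTheory ContinuousCohomology Function Field ValuativeRel NumberField IsDedekindDomain
open Literature.NumberTheory.GaloisRepresentations
open Literature.NumberTheory.GaloisRepresentations.IsNonarchimedeanLocalField
open _root_.TopRep
open Literature.NumberTheory.GaloisCohomology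
open Summit.BirchSwinnertonDyer.Rank1Residual.GaloisImage
open Summit.BirchSwinnertonDyer.Rank1Residual (X11b.LocBridge.mem_unramifiedSubgroup_one_iff_forall_eq_zero)

/-! ## §4 Assembly at an `E`-split prime: `H¹(K_q, 𝒯_J) = H¹_ur ⊕ H¹_tr`, `#H¹_ur = #H¹_tr = #𝒯_J[T^{p^m}]` -/

section Assembly

open Literature.NumberTheory.EllipticCurves

variable {K : Type u} [Field K] [NumberField K] {M : Type u} [AddCommGroup M] [TopologicalSpace M]
  [DiscreteTopology M] (ρ : DiscreteGaloisModule K M) {p : ℕ} [Fact p.Prime]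
  (hM : ∀ x : M, p • x = 0) (κ : ZpExtension K p) (J : ℕ) (q : HeightOneSpectrum (𝓞 K))

/-- **LEMMA 1 (ii) of MU-TRANSFER-PROOF on the genuine local twist — the direct sum.**  At a finite
place `q` of `K` with `q ∤ p`, `ρ` unramified at `q`, `N(q) = ℓ` prime with `p ∣ ℓ − 1`, and `χ̄_ℓ`
onto on the inertia of `K_q` (`hχI`; over `ℚ` the fact `modPCyclotomicCharacter_surjOn_absInertia_rat`),
the local cohomology of `𝒯_J = κ.twistModP ρ J` is the DIRECT SUM of its unramified subgroup and its
`K_q(μ_ℓ)`-transverse subgroup: `H¹(K_q, 𝒯_J) = H¹_ur ⊕ H¹_tr`.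
[cite: Rubin2011, Prop. 1.9.5 (3) (p. 16)] [cite: MazurRubin2004, Lemma 1.2.4] -/
theorem isCompl_unramified_transverse_toLocal_twistModP [Finite M]
    [Fact (Ideal.absNorm q.asIdeal).Prime]
    [NeZero ((Ideal.absNorm q.asIdeal : ℕ) : q.adicCompletion K)]
    (hunr : GaloisRep.IsUnramifiedAt q ρ) (hqp : (p : 𝓞 K) ∉ q.asIdeal)
    (hpl : p ∣ Ideal.absNorm q.asIdeal - 1)
    (hχI : ∀ u : (ZMod (Ideal.absNorm q.asIdeal))ˣ, ∃ t ∈ absInertia (q.adicCompletion K),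
      modPCyclotomicCharacterZMod (q.adicCompletion K) (Ideal.absNorm q.asIdeal) t = u) :
    IsCompl (DiscreteGaloisModule.unramifiedSubgroup (GaloisRep.toLocal q (κ.twistModP ρ hM J)) 1)
      (DiscreteGaloisModule.transverseSubgroup (GaloisRep.toLocal q (κ.twistModP ρ hM J))
        (CyclotomicField (Ideal.absNorm q.asIdeal) (q.adicCompletion K))) :=
  isCompl_unramifiedSubgroup_transverseSubgroup_cyclotomicField _ _
    (ringChar_residueField_adicCompletion_eq q)
    (fun _ ht x => toLocal_twistModP_apply_of_mem_absInertia ρ hM κ J q hunr hqp ht x)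
    (sub_one_smul_eq_zero_of_dvd hM hpl) hχI

/-- **LEMMA 1 (ii), the counts at an `E`-split Frobenius of depth `m`**: with `φ` a Frobenius of
`K_q` whose restriction to `K̄` acts trivially on `M` (`q` is `E`-split) and lies in
`Gal(K̄/K_m) ∖ Gal(K̄/K_{m+1})` (`q` has depth `m`, i.e. `e_q = p^m`; `m + 1 ≤ J`):
`#H¹_tr(K_q, 𝒯_J) = #H¹_ur(K_q, 𝒯_J) = #𝒯_J[T^{p^m}]` (`= #𝒯_e` at `J = 2e`, `e = p^m`: the memo's
`H¹_ur ≅ 𝒯_e`, `H¹_tr ≅ T^e𝒯_J`). [cite: Rubin2011, Prop. 1.9.5 (1)–(2) (p. 16)] [cite: MazurRubin2004, Lemma 1.2.1] -/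
theorem natCard_transverse_toLocal_twistModP_of_split [Finite M]
    [Fact (Ideal.absNorm q.asIdeal).Prime]
    [NeZero ((Ideal.absNorm q.asIdeal : ℕ) : q.adicCompletion K)]
    (hunr : GaloisRep.IsUnramifiedAt q ρ) (hqp : (p : 𝓞 K) ∉ q.asIdeal)
    (hpl : p ∣ Ideal.absNorm q.asIdeal - 1)
    (hχI : ∀ u : (ZMod (Ideal.absNorm q.asIdeal))ˣ, ∃ t ∈ absInertia (q.adicCompletion K),
      modPCyclotomicCharacterZMod (q.adicCompletion K) (Ideal.absNorm q.asIdeal) t = u)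
    {φ : absoluteGaloisGroup (q.adicCompletion K)} (hφ : IsFrobPow φ 1)
    (hsplit : ρ (absGaloisRestrict K (q.adicCompletion K) φ) = 1) {m : ℕ} (hm : m + 1 ≤ J)
    (hφm : absGaloisRestrict K (q.adicCompletion K) φ ∈ κ.layerSubgroup m)
    (hφm' : absGaloisRestrict K (q.adicCompletion K) φ ∉ κ.layerSubgroup (m + 1)) :
    Nat.card (DiscreteGaloisModule.transverseSubgroup (GaloisRep.toLocal q (κ.twistModP ρ hM J))
        (CyclotomicField (Ideal.absNorm q.asIdeal) (q.adicCompletion K))) =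
      Nat.card {x : Fin J → M // (shiftEnd M J ^ (p ^ m)) x = 0} ∧
    Nat.card (DiscreteGaloisModule.unramifiedSubgroup (GaloisRep.toLocal q (κ.twistModP ρ hM J)) 1) =
      Nat.card {x : Fin J → M // (shiftEnd M J ^ (p ^ m)) x = 0} := by
  have hI : ∀ t ∈ absInertia (q.adicCompletion K), ∀ x : Fin J → M,
      GaloisRep.toLocal q (κ.twistModP ρ hM J) t x = x :=
    fun _ ht x => toLocal_twistModP_apply_of_mem_absInertia ρ hM κ J q hunr hqp ht x
  have hfix : Nat.card {x : Fin J → M // GaloisRep.toLocal q (κ.twistModP ρ hM J) φ x = x} =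
      Nat.card {x : Fin J → M // (shiftEnd M J ^ (p ^ m)) x = 0} :=
    Nat.card_congr (Equiv.subtypeEquivRight fun x =>
      toLocal_twistModP_apply_eq_self_iff_of_split ρ hM κ J q hsplit hm hφm hφm' x)
  have htr := natCard_transverseSubgroup_cyclotomicField_eq_natCard_fixedPoints
    (GaloisRep.toLocal q (κ.twistModP ρ hM J)) (Ideal.absNorm q.asIdeal) hI
    (sub_one_smul_eq_zero_of_dvd hM hpl) hχI hφ
  refine ⟨htr.trans hfix, ?_⟩
  rw [← natCard_transverseSubgroup_cyclotomicField_eq_natCard_unramifiedSubgroup _ _ hI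
    (sub_one_smul_eq_zero_of_dvd hM hpl) hχI, htr, hfix]

omit [TopologicalSpace M] [DiscreteTopology M] [Fact p.Prime] in
/-- `#𝒯_J[T^e] = #M^e` for `e ≤ J` (`𝒯_J[T^e] = T^{J−e}𝒯_J` is spanned by the top `e` coordinates).
[cite: Washington1997, §13.1–§13.2] -/
theorem natCard_shiftEnd_pow_ker [Finite M] {e : ℕ} (he : e ≤ J) :
    Nat.card {x : Fin J → M // (shiftEnd M J ^ e) x = 0} = Nat.card M ^ e := by
  have hfun : Nat.card (Fin e → M) = Nat.card M ^ e := by rw [Nat.card_fun, Nat.card_fin]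
  rw [← hfun]
  refine Nat.card_congr
    { toFun := fun x i => x.1 ⟨J - e + i, by omega⟩
      invFun := fun y => ⟨fun j => if h : J - e ≤ (j : ℕ) then y ⟨(j : ℕ) - (J - e), by omega⟩ else 0,
        (shiftEnd_pow_apply_eq_zero_iff e _).2 fun j hj => by simp only [dif_neg (by omega : ¬ J - e ≤ (j : ℕ))]⟩
      left_inv := fun x => Subtype.ext (funext fun j => ?_)
      right_inv := fun y => funext fun i => ?_ }
  · dsimp only
    by_cases h : J - e ≤ (j : ℕ)
    · rw [dif_pos h]
      exact congrArg x.1 (Fin.ext (Nat.add_sub_of_le h))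
    · rw [dif_neg h]
      exact ((shiftEnd_pow_apply_eq_zero_iff e x.1).1 x.2 j (by omega)).symm
  · dsimp only
    rw [dif_pos (Nat.le_add_right _ _)]
    exact congrArg y (Fin.ext (Nat.add_sub_cancel_left (J - e) (i : ℕ)))

end Assembly

/-! ## Append no. 1: the invariants of the local twist at an `E`-split prime, and the total count -/

section AssemblyTwo

open Literature.NumberTheory.EllipticCurves

variable {K : Type u} [Field K] [NumberField K] {M : Type u} [AddCommGroup M] [TopologicalSpace M]
  [DiscreteTopology M] (ρ : DiscreteGaloisModule K M) {p : ℕ} [Fact p.Prime]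
  (hM : ∀ x : M, p • x = 0) (κ : ZpExtension K p) (J : ℕ) (q : HeightOneSpectrum (𝓞 K))

/-- **`(𝒯_J|_q)^{Γ_{K_q}} = 𝒯_J[T^{p^m}]`**: at a finite place `q ∤ p` with `ρ` unramified and an `E`-split
local Frobenius `φ` of depth `m` (`m + 1 ≤ J`), a vector of the local twist is fixed by ALL of `Γ_{K_q}`
iff it is killed by `S^{p^m}` (inertia acts trivially, so invariants = fixed points of `φ` —
x9 `forall_apply_eq_iff_of_isFrobPow` — = `ker S^{p^m}` by file 2).  This is the target `M^{Γ_F}` of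
file 4's `exists_transverseSubgroup_addEquiv_invariants` for the local twist: the memo's
`H¹_tr ≅ 𝒯_J^{φ̃=1} = T^{J−e}𝒯_J` (value at `σ̄`). [cite: MazurRubin2004, Lemma 1.2.1]
[cite: Rubin2011, Prop. 1.9.5 (1) (p. 16)] -/
theorem forall_toLocal_twistModP_apply_eq_self_iff_of_split
    (hunr : GaloisRep.IsUnramifiedAt q ρ) (hqp : (p : 𝓞 K) ∉ q.asIdeal)
    {φ : absoluteGaloisGroup (q.adicCompletion K)} (hφ : IsFrobPow φ 1)
    (hsplit : ρ (absGaloisRestrict K (q.adicCompletion K) φ) = 1) {m : ℕ} (hm : m + 1 ≤ J)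
    (hφm : absGaloisRestrict K (q.adicCompletion K) φ ∈ κ.layerSubgroup m)
    (hφm' : absGaloisRestrict K (q.adicCompletion K) φ ∉ κ.layerSubgroup (m + 1)) (x : Fin J → M) :
    (∀ g : absoluteGaloisGroup (q.adicCompletion K), GaloisRep.toLocal q (κ.twistModP ρ hM J) g x = x) ↔
      (shiftEnd M J ^ (p ^ m)) x = 0 := by
  have hI : ∀ t ∈ absInertia (q.adicCompletion K), ∀ y : Fin J → M,
      GaloisRep.toLocal q (κ.twistModP ρ hM J) t y = y :=
    fun _ ht y => toLocal_twistModP_apply_of_mem_absInertia ρ hM κ J q hunr hqp ht y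
  rw [forall_apply_eq_iff_of_isFrobPow (GaloisRep.toLocal q (κ.twistModP ρ hM J)) hI hφ x]
  exact toLocal_twistModP_apply_eq_self_iff_of_split ρ hM κ J q hsplit hm hφm hφm' x

/-- **The total count `#H¹(K_q, 𝒯_J) = (#M^{p^m})²`** at an `E`-split prime of depth `m` with `p^m ≤ J`
(`= #H¹_ur · #H¹_tr`, both `= #𝒯_J[T^{p^m}] = #M^{p^m}`): MU-TRANSFER-PROOF Lemma 1 (ii) "orders
`#H¹ = #H⁰·#H² = p^{2e}·p^{2e}`" at `J = 2e`, `M = E[p]`. [cite: Rubin2011, Prop. 1.9.5 (p. 16)] -/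
theorem natCard_galoisCohomology_toLocal_twistModP_of_split [Finite M]
    [Fact (Ideal.absNorm q.asIdeal).Prime]
    [NeZero ((Ideal.absNorm q.asIdeal : ℕ) : q.adicCompletion K)]
    (hunr : GaloisRep.IsUnramifiedAt q ρ) (hqp : (p : 𝓞 K) ∉ q.asIdeal)
    (hpl : p ∣ Ideal.absNorm q.asIdeal - 1)
    (hχI : ∀ u : (ZMod (Ideal.absNorm q.asIdeal))ˣ, ∃ t ∈ absInertia (q.adicCompletion K),
      modPCyclotomicCharacterZMod (q.adicCompletion K) (Ideal.absNorm q.asIdeal) t = u)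
    {φ : absoluteGaloisGroup (q.adicCompletion K)} (hφ : IsFrobPow φ 1)
    (hsplit : ρ (absGaloisRestrict K (q.adicCompletion K) φ) = 1) {m : ℕ} (hm : m + 1 ≤ J)
    (hpm : p ^ m ≤ J)
    (hφm : absGaloisRestrict K (q.adicCompletion K) φ ∈ κ.layerSubgroup m)
    (hφm' : absGaloisRestrict K (q.adicCompletion K) φ ∉ κ.layerSubgroup (m + 1)) :
    Nat.card (galoisCohomology (GaloisRep.toLocal q (κ.twistModP ρ hM J)) 1) =
      Nat.card M ^ (p ^ m) * Nat.card M ^ (p ^ m) := by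
  obtain ⟨htr, hur⟩ := natCard_transverse_toLocal_twistModP_of_split ρ hM κ J q hunr hqp hpl hχI hφ
    hsplit hm hφm hφm'
  rw [natCard_galoisCohomology_one_eq_mul _ (Ideal.absNorm q.asIdeal)
      (ringChar_residueField_adicCompletion_eq q)
      (fun _ ht x => toLocal_twistModP_apply_of_mem_absInertia ρ hM κ J q hunr hqp ht x)
      (sub_one_smul_eq_zero_of_dvd hM hpl) hχI,
    hur, htr, natCard_shiftEnd_pow_ker J hpm]

end AssemblyTwo

end Summit.BirchSwinnertonDyer.BirchSwinnertonDyer.Rank1Residual.LocalSplitPrime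

end
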